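import Mathlib
import HarnessLib
import Summits.CriticalPhenomena.Ising3DConformalLimit.Theorems.ModularBoostsLimitRotationInvariance

/-!
# `LimitRotationInvariance` (route ModularBoosts, milestone item stmt-CriticalPhenomena-5434):
# the Gaussian case is settled — only interacting limits are open

The milestone `ModularBoosts.LimitRotationInvariance` (every normalised, non-degenerate,
translation-invariant, scale-covariant pointwise scaling limit `S` of the critical nearest-neighbour
Ising correlators on `ℤ³` is `O(3)`-invariant at every level `n`) is rotation invariance of the
critical `ℤ³` Ising scaling limit, open (H. Duminil-Copin, ICM 2022, §8.1) and equivalent to the crux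
`HyperoctahedralRP.LimitRotationInvariant` (`limitRotationInvariance_iff_hyperoctahedral`). The tree
settles the levels `n ≤ 2` (two-point isotropy, `rotation_invariant_of_le_two`) and the odd levels
(`rotation_invariant_of_odd`). This file settles the **Gaussian case**:

* `pairingSum_two_rotate`: the Wick pairing functional `𝒢_m[S₂]` of the two-point function of such
  a limit is `O(3)`-invariant (each factor is a rotated two-point value);
* `rotation_invariant_of_wick`: if the connected four-point function `U₄^S` vanishes on
  non-coincident quadruples, then `S` is `O(3)`-invariant at ALL levels — by Aizenman's Gaussian
  dichotomy (tree theorem `HasPointwiseScalingLimit.eq_pairingSum_of_limitConnectedFour_eq_zero`: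
  `U₄ ≡ 0` forces Wick's rule `S_{2m} = 𝒢_m[S₂]` on non-coincident configurations) and the
  isotropy of `S₂`;
* `rotation_invariant_of_not_hasNontrivialU4`: the same with the hypothesis `¬ HasNontrivialU4 S`;
* `limitRotationInvariance_iff_hasNontrivialU4`: hence the milestone is EQUIVALENT to its
  restriction to interacting limits (`HasNontrivialU4 S`, clause (iii) of the conformal-limit
  problem): a counterexample to rotation invariance of the critical `ℤ³` Ising scaling limit is
  necessarily non-Gaussian;
* `limitRotationInvariance_iff_hasNontrivialU4_even_four_le`: combined with the tree's level
  reduction, what is open is exactly: interacting limits, even levels `n ≥ 4`, non-coincident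
  configurations.

References: M. Aizenman, Comm. Math. Phys. 86 (1982), Prop. 12.1; M. Aizenman, *A geometric
perspective on the scaling limits of critical Ising and `φ⁴_d` models*, CDM 2020, §7 (remark after
Prop. 7.2); C. M. Newman, Comm. Math. Phys. 41 (1975); H. Duminil-Copin, Proc. ICM 2022, §8.1.
No definitions are introduced.
-/

noncomputable section

namespace Summit.CriticalPhenomena.Ising3DConformalLimit.ModularBoostsRotation

open Literature.Probability.LatticeModels
open Summit.CriticalPhenomena.Ising3DConformalLimit.Theses
open Summit.CriticalPhenomena.Ising3DConformalLimit.Theses.ModularBoosts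
open Summit.CriticalPhenomena.Ising3DConformalLimit.MoebiusLimitExistsNegative

variable {ρ : ℝ → ℝ} {Δ : ℝ} {S : CorrFamily 3}

/-! ### The Wick pairing functional of the two-point function is `O(3)`-invariant -/

/-- A rotated pair: `(R a, R b)` is the image of the configuration `(a, b)`. [folklore] -/
theorem rotate_pair (R : EuclideanSpace ℝ (Fin 3) ≃ₗᵢ[ℝ] EuclideanSpace ℝ (Fin 3))
    (a b : EuclideanSpace ℝ (Fin 3)) :
    (fun k => R ((![a, b] : Fin 2 → EuclideanSpace ℝ (Fin 3)) k)) = ![R a, R b] := by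
  funext k
  fin_cases k <;> rfl

/-- **`𝒢_m[S₂]` is `O(3)`-invariant.** For a normalised, non-degenerate, translation-invariant,
scale-covariant pointwise limit `S` of `criticalCorr 3`, the Wick pairing functional of its
two-point function `S₂(p, q) = S 2 (p, q)` takes the same value at a configuration and at its image
under any linear isometry `R`: every factor `S₂(R xᵢ, R xⱼ) = S₂(xᵢ, xⱼ)` by the settled level
`n = 2` (`rotation_invariant_of_le_two`). [cite: DuminilCopinICM2022, §8.1] -/
theorem pairingSum_two_rotate (hρ : ∀ δ ∈ Set.Ioc (0:ℝ) 1, 0 < ρ δ)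
    (hlim : HasPointwiseScalingLimit (criticalCorr 3) ρ S)
    (hnorm : ∀ n z, z ∉ NonCoincident 3 n → S n z = 0) (hnd : IsNondegenerateTwoPoint S)
    (htr : IsTranslationInvariant S) (hsc : IsScaleCovariant Δ S) (m : ℕ)
    (R : EuclideanSpace ℝ (Fin 3) ≃ₗᵢ[ℝ] EuclideanSpace ℝ (Fin 3))
    (x : Fin (2 * m) → EuclideanSpace ℝ (Fin 3)) :
    pairingSum (fun p q => S 2 ![p, q]) m (fun i => R (x i)) =
      pairingSum (fun p q => S 2 ![p, q]) m x := by
  have h := PairIsing.pairingSum_eq_pow_mul (fun p q => S 2 ![p, q]) (fun p q => S 2 ![p, q]) 1 m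
    x (fun i => R (x i)) (fun i j _ => by
      rw [one_mul, ← rotate_pair R (x i) (x j)]
      exact rotation_invariant_of_le_two hρ hlim hnorm hnd htr hsc le_rfl R ![x i, x j])
  rw [h, one_pow, one_mul]

/-! ### The Gaussian case of the milestone -/

/-- **Gaussian limits are isotropic.** Let `S` be a normalised, non-degenerate,
translation-invariant, scale-covariant pointwise scaling limit of `criticalCorr 3` whose connected
four-point function `U₄^S = limitConnectedFour S` vanishes at every non-coincident quadruple. Then
`S` is `O(3)`-invariant at every level and every configuration: at even levels `2m ≥ 4` and
non-coincident configurations `S_{2m} = 𝒢_m[S₂]` by Aizenman's Gaussian dichotomy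
(`HasPointwiseScalingLimit.eq_pairingSum_of_limitConnectedFour_eq_zero`), which is rotation
invariant by `pairingSum_two_rotate`; levels `≤ 2`, odd levels and coincident configurations are
settled by `rotation_invariant_of_le_two`, `rotation_invariant_of_odd` and the normalisation.
[cite: AizenmanCDM2020, §7, Prop. 7.2 and the remark following it (p. 23)]
[cite: AizenmanCMP1982, Prop. 12.1] -/
theorem rotation_invariant_of_wick (hρ : ∀ δ ∈ Set.Ioc (0:ℝ) 1, 0 < ρ δ)
    (hlim : HasPointwiseScalingLimit (criticalCorr 3) ρ S)
    (hnorm : ∀ n z, z ∉ NonCoincident 3 n → S n z = 0) (hnd : IsNondegenerateTwoPoint S)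
    (htr : IsTranslationInvariant S) (hsc : IsScaleCovariant Δ S)
    (hU : ∀ z ∈ NonCoincident 3 4, limitConnectedFour S z = 0) : IsRotationInvariant S := by
  intro n R x
  rcases Nat.even_or_odd n with hev | hodd
  · obtain ⟨m, rfl⟩ := even_iff_two_dvd.1 hev
    by_cases hm : 2 ≤ m
    · by_cases hx : x ∈ NonCoincident 3 (2 * m)
      · have hRx : (fun i => R (x i)) ∈ NonCoincident 3 (2 * m) :=
          (map_mem_nonCoincident_iff R x).2 hx
        rw [hlim.eq_pairingSum_of_limitConnectedFour_eq_zero le_rfl hU hm hRx,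
          hlim.eq_pairingSum_of_limitConnectedFour_eq_zero le_rfl hU hm hx]
        exact pairingSum_two_rotate hρ hlim hnorm hnd htr hsc m R x
      · rw [hnorm _ x hx, hnorm _ _ (mt (map_mem_nonCoincident_iff R x).1 hx)]
    · exact rotation_invariant_of_le_two hρ hlim hnorm hnd htr hsc (by omega) R x
  · exact rotation_invariant_of_odd hlim hnorm hodd R x

/-- **Gaussian limits are isotropic**, with the hypothesis in the form `¬ HasNontrivialU4 S`
(no non-coincident quadruple with `U₄ ≠ 0`). [cite: AizenmanCDM2020, §7, remark after Prop. 7.2 (p. 23)] -/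
theorem rotation_invariant_of_not_hasNontrivialU4 (hρ : ∀ δ ∈ Set.Ioc (0:ℝ) 1, 0 < ρ δ)
    (hlim : HasPointwiseScalingLimit (criticalCorr 3) ρ S)
    (hnorm : ∀ n z, z ∉ NonCoincident 3 n → S n z = 0) (hnd : IsNondegenerateTwoPoint S)
    (htr : IsTranslationInvariant S) (hsc : IsScaleCovariant Δ S) (hG : ¬ HasNontrivialU4 S) :
    IsRotationInvariant S := by
  refine rotation_invariant_of_wick hρ hlim hnorm hnd htr hsc fun z hz => ?_
  by_contra hz0
  exact hG ⟨z, hz, hz0⟩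

/-! ### The milestone is its interacting case -/

/-- **`LimitRotationInvariance` is equivalent to its restriction to interacting limits.** Rotation
invariance of every normalised, non-degenerate, translation-invariant, scale-covariant pointwise
limit of `criticalCorr 3` holds if (and trivially only if) it holds for those limits with
`HasNontrivialU4 S` (`U₄ ≢ 0` on non-coincident quadruples): the Gaussian ones are isotropic by
`rotation_invariant_of_not_hasNontrivialU4`. So a scaling limit of the critical `ℤ³` Ising model
violating rotation invariance would have to be non-Gaussian. [cite: DuminilCopinICM2022, §8.1] -/
theorem limitRotationInvariance_iff_hasNontrivialU4 :
    LimitRotationInvariance ↔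
      ∀ (ρ : ℝ → ℝ) (Δ : ℝ) (S : CorrFamily 3), (∀ δ ∈ Set.Ioc (0:ℝ) 1, 0 < ρ δ) →
        HasPointwiseScalingLimit (criticalCorr 3) ρ S →
        (∀ n z, z ∉ NonCoincident 3 n → S n z = 0) → IsNondegenerateTwoPoint S →
        IsTranslationInvariant S → IsScaleCovariant Δ S → HasNontrivialU4 S →
        IsRotationInvariant S := by
  constructor
  · intro h ρ Δ S hρ hlim hnorm hnd htr hsc _
    exact h ρ Δ S hρ hlim hnorm hnd htr hsc
  · intro h ρ Δ S hρ hlim hnorm hnd htr hsc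
    by_cases hG : HasNontrivialU4 S
    · exact h ρ Δ S hρ hlim hnorm hnd htr hsc hG
    · exact rotation_invariant_of_not_hasNontrivialU4 hρ hlim hnorm hnd htr hsc hG

/-- Hence the milestone follows from rotation invariance of the interacting limits alone.
[cite: DuminilCopinICM2022, §8.1] -/
theorem limitRotationInvariance_of_hasNontrivialU4
    (h : ∀ (ρ : ℝ → ℝ) (Δ : ℝ) (S : CorrFamily 3), (∀ δ ∈ Set.Ioc (0:ℝ) 1, 0 < ρ δ) →
        HasPointwiseScalingLimit (criticalCorr 3) ρ S →
        (∀ n z, z ∉ NonCoincident 3 n → S n z = 0) → IsNondegenerateTwoPoint S →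
        IsTranslationInvariant S → IsScaleCovariant Δ S → HasNontrivialU4 S →
        IsRotationInvariant S) :
    LimitRotationInvariance :=
  limitRotationInvariance_iff_hasNontrivialU4.2 h

/-- **What is open, exactly.** `LimitRotationInvariance` is equivalent to: for every normalised,
non-degenerate, translation-invariant, scale-covariant pointwise limit `S` of `criticalCorr 3` WITH
`HasNontrivialU4 S`, `O(3)` invariance at the even levels `n ≥ 4` on non-coincident configurations
(Gaussian limits by `rotation_invariant_of_not_hasNontrivialU4`; levels `n ≤ 2`, odd levels and
coincident configurations by `limitRotationInvariance_iff_even_four_le`).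
[cite: DuminilCopinICM2022, §8.1] -/
theorem limitRotationInvariance_iff_hasNontrivialU4_even_four_le :
    LimitRotationInvariance ↔
      ∀ (ρ : ℝ → ℝ) (Δ : ℝ) (S : CorrFamily 3), (∀ δ ∈ Set.Ioc (0:ℝ) 1, 0 < ρ δ) →
        HasPointwiseScalingLimit (criticalCorr 3) ρ S →
        (∀ n z, z ∉ NonCoincident 3 n → S n z = 0) → IsNondegenerateTwoPoint S →
        IsTranslationInvariant S → IsScaleCovariant Δ S → HasNontrivialU4 S →
        ∀ n : ℕ, Even n → 4 ≤ n →
          ∀ (R : EuclideanSpace ℝ (Fin 3) ≃ₗᵢ[ℝ] EuclideanSpace ℝ (Fin 3))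
            (x : Fin n → EuclideanSpace ℝ (Fin 3)), x ∈ NonCoincident 3 n →
            S n (fun i => R (x i)) = S n x := by
  constructor
  · intro h ρ Δ S hρ hlim hnorm hnd htr hsc _ n _ _ R x _
    exact h ρ Δ S hρ hlim hnorm hnd htr hsc n R x
  · intro h
    refine limitRotationInvariance_iff_hasNontrivialU4.2 fun ρ Δ S hρ hlim hnorm hnd htr hsc hG => ?_
    intro n R x
    rcases Nat.even_or_odd n with hev | hodd
    · by_cases hn : n ≤ 2
      · exact rotation_invariant_of_le_two hρ hlim hnorm hnd htr hsc hn R x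
      · by_cases hx : x ∈ NonCoincident 3 n
        · have h4 : 4 ≤ n := by
            obtain ⟨k, rfl⟩ := hev
            omega
          exact h ρ Δ S hρ hlim hnorm hnd htr hsc hG n hev h4 R x hx
        · rw [hnorm n x hx, hnorm n _ (mt (map_mem_nonCoincident_iff R x).1 hx)]
    · exact rotation_invariant_of_odd hlim hnorm hodd R x

/-- Hence the milestone follows from `O(3)` invariance of the interacting limits at the even levels
`n ≥ 4` on non-coincident configurations alone. [cite: DuminilCopinICM2022, §8.1] -/
theorem limitRotationInvariance_of_hasNontrivialU4_even_four_le
    (h : ∀ (ρ : ℝ → ℝ) (Δ : ℝ) (S : CorrFamily 3), (∀ δ ∈ Set.Ioc (0:ℝ) 1, 0 < ρ δ) →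
        HasPointwiseScalingLimit (criticalCorr 3) ρ S →
        (∀ n z, z ∉ NonCoincident 3 n → S n z = 0) → IsNondegenerateTwoPoint S →
        IsTranslationInvariant S → IsScaleCovariant Δ S → HasNontrivialU4 S →
        ∀ n : ℕ, Even n → 4 ≤ n →
          ∀ (R : EuclideanSpace ℝ (Fin 3) ≃ₗᵢ[ℝ] EuclideanSpace ℝ (Fin 3))
            (x : Fin n → EuclideanSpace ℝ (Fin 3)), x ∈ NonCoincident 3 n →
            S n (fun i => R (x i)) = S n x) :
    LimitRotationInvariance :=
  limitRotationInvariance_iff_hasNontrivialU4_even_four_le.2 h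

end Summit.CriticalPhenomena.Ising3DConformalLimit.ModularBoostsRotation

end
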